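import Summits.AtomisticToContinuum.HydrodynamicLimit.Theses.EnskogAdjointDuality

/-!
# Record of the dropped route item `EnskogAdjointDuality.AdjointEnskogTestFamily` (stmt-AtomisticToContinuum-9168)

Route `AtomisticToContinuum/EnskogAdjointDuality` dropped its item `AdjointEnskogTestFamily`
(stmt-AtomisticToContinuum-9168) after it was closed `refuted` (commit 61f90dc23865) by
`Summit.AtomisticToContinuum.HydrodynamicLimit.Theorems.EnskogAdjointDualityAdjointEnskogTestFamily_refuted`
(`Theorems/EnskogAdjointDualityAdjointEnskogTestFamilyRefutation.lean`). The gate-written route file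
`Theses/EnskogAdjointDuality.lean` therefore no longer declares the constant, while the refutation — a
Theorems file, append-only, whose statement text may not change — still names it ("Unknown
identifier", full builds of 2026-08-16). This module re-declares the constant under its ORIGINAL
fully-qualified name with its ORIGINAL definiens (the item's ledger signature, verbatim, in the
route file's namespace and `open` context), so that the refutation record elaborates again; it is
imported by that file only (397 lines = at the 400-line cap of Theorems files, hence the separate
module). NOT a route item (no `route_item` attribute); FALSE (see the refutation).
-/

namespace Summit.AtomisticToContinuum.HydrodynamicLimit.Theses.EnskogAdjointDuality

open scoped BigOperators Topology Manifold Classical MeasureTheory ProbabilityTheory Matrix InnerProductSpace ComplexConjugate ContinuousMap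
open Filter Set Function TopologicalSpace MeasureTheory

/-- **Record of the dropped route item `AdjointEnskogTestFamily`** = stmt-AtomisticToContinuum-9168
(ledger signature verbatim; NOT a route item; FALSE —
`Theorems.EnskogAdjointDualityAdjointEnskogTestFamily_refuted`). Re-declared only so that the
refutation record keeps elaborating (see the module docstring). -/
def AdjointEnskogTestFamily : Prop :=
  ∃ σ₀ : ℝ, 0 < σ₀ ∧ ∀ σ : ℝ, 0 < σ → σ < σ₀ → ∀ (T : ℝ) (ρ θ : ℝ → UnitAddTorus (Fin 3) → ℝ) (u : ℝ → UnitAddTorus (Fin 3) → EuclideanSpace ℝ (Fin 3)), Literature.MathematicalPhysics.KineticTheory.IsHardSphereEulerSolution σ T ρ u θ → ∀ t ∈ Set.Ioo 0 T, ∀ χ : UnitAddTorus (Fin 3) → ℝ, Literature.Analysis.FunctionSpaces.Torus.IsSmooth χ → ∀ (a e : ℝ) (b : EuclideanSpace ℝ (Fin 3)), ∃ (c : ℕ → ℝ → UnitAddTorus (Fin 3) → ℝ × EuclideanSpace ℝ (Fin 3) × ℝ) (κ : ℕ → ℝ → UnitAddTorus (Fin 3) → EuclideanSpace ℝ (Fin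 3) → ℝ), (∀ N, Continuous (Function.uncurry (c N))) ∧ (∀ N, Continuous (fun p : ℝ × UnitAddTorus (Fin 3) × EuclideanSpace ℝ (Fin 3) => κ N p.1 p.2.1 p.2.2)) ∧ (∃ C : ℝ, ∀ N s x x' v v', ‖c N s x‖ ≤ C ∧ dist (c N s x) (c N s x') ≤ C * dist x x' ∧ |κ N s x v| ≤ C * (1 + ‖v‖ ^ 2) ∧ |κ N s x v - κ N s x' v'| ≤ C * (1 + ‖v‖ ^ 2 + ‖v'‖ ^ 2) * (dist x x' + ‖v - v'‖)) ∧ (let G := Literature.Analysis.FluidPDE.Torus.geometry (Fin 3); let ε := fun N : ℕ => Literature.MathematicalPhysics.KineticTheory.hsDiameter σ N; let lam := fun N : ℕ => (N : ℝ) * ε N ^ 2; let f := fun (s : ℝ) (x : UnitAddTorus (Fin 3)) (v : EuclideanSpace ℝ (Fin 3)) => ρ s x * Literature.Analysis.FluidPDE.localMaxwellian 1 (θ s x) (u s x) v; let Y := fun η : ℝ => 3 / (2 * Real.pi) * deriv Literature.MathematicalPhysics.KineticTheory.hsExcessFreeEnergy η; let φ := fun (N : ℕ) (s : ℝ) (x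 : UnitAddTorus (Fin 3)) (v : EuclideanSpace ℝ (Fin 3)) => (c N s x).1 + inner ℝ (c N s x).2.1 v + (c N s x).2.2 * ‖v‖ ^ 2 / 2 + (lam N)⁻¹ * κ N s x v; let L := fun (N : ℕ) (s : ℝ) (x : UnitAddTorus (Fin 3)) (v : EuclideanSpace ℝ (Fin 3)) => lam N * ∫ ω : Metric.sphere (0 : EuclideanSpace ℝ (Fin 3)) 1, (let y := G.translate x (ε N • (ω : EuclideanSpace ℝ (Fin 3))); ∫ w : EuclideanSpace ℝ (Fin 3), max (inner ℝ (v - w) ω) 0 * Y (σ ^ 3 * ρ s (G.translate x ((ε N / 2) • (ω : EuclideanSpace ℝ (Fin 3))))) * f s y w * (φ N s x (v - inner ℝ (v - w) ω • (ω : EuclideanSpace ℝ (Fin 3))) + φ N s y (w + inner ℝ (v - w) ω • (ω : EuclideanSpace ℝ (Fin 3))) - φ N s x v - φ N s y w)) ∂Literature.MathematicalPhysics.KineticTheory.sphereMeasure; (∀ N x v, φ N t x v = χ x * (a + inner ℝ b v + e * ‖v‖ ^ 2 / 2)) ∧ (∀ N x v, ContDiffOn ℝ 1 (fun r => φ N r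 (G.translate x (r • v)) v) (Set.Icc 0 t)) ∧ (∃ η : ℕ → ℝ, Filter.Tendsto η Filter.atTop (nhds 0) ∧ ∀ N, ∀ s ∈ Set.Icc 0 t, ∀ x v, |derivWithin (fun r => φ N r (G.translate x ((r - s) • v)) v) (Set.Icc 0 t) s + L N s x v| ≤ η N * (1 + ‖v‖ ^ 2)) ∧ (∃ c₀ : UnitAddTorus (Fin 3) → ℝ × EuclideanSpace ℝ (Fin 3) × ℝ, Continuous c₀ ∧ ∀ δ : ℝ, 0 < δ → ∀ᶠ N in Filter.atTop, ∀ x, dist (c N 0 x) (c₀ x) ≤ δ) ∧ Filter.Tendsto (fun N : ℕ => (∫ x : UnitAddTorus (Fin 3), ∫ v : EuclideanSpace ℝ (Fin 3), f t x v * φ N t x v) - (∫ x : UnitAddTorus (Fin 3), ∫ v : EuclideanSpace ℝ (Fin 3), f 0 x v * φ N 0 x v) - ∫ s in Set.Icc 0 t, ∫ x : UnitAddTorus (Fin 3), ∫ v : EuclideanSpace ℝ (Fin 3), f s x v * (derivWithin (fun r => φ N r (G.translate x ((r - s) • v)) v) (Set.Icc 0 t) s + (1 / 2 : ℝ) * L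 N s x v)) Filter.atTop (nhds 0))

end Summit.AtomisticToContinuum.HydrodynamicLimit.Theses.EnskogAdjointDuality
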